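import Literature.AnabelianGeometry.SemiGraphs.Pullback

/-!
# Fibres of a graph-covering and the branch bijections ([SemiAnbd] §1 p. 14; §2 p. 23)

Mochizuki, *Semi-graphs of anabelioids*, Publ. RIMS **42** (2006) 221–322
[cite: MochizukiSemiAnbd2006, §1 p.14].  A graph-covering `ψ : 𝔾' → 𝔾` (p. 14: a proper
excision — bijective on the branches at every vertex) has, for every branch `b` of an edge `e`
abutting to a vertex `v`, a canonical bijection between the fibre over `v` and the fibre over `e`:
a vertex `v'` over `v` carries exactly one branch `b'` over `b` (excision), whose edge lies over
`e`; conversely an edge `e'` over `e` has exactly one branch over `b` (morphisms are bijective on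
the branches of an edge), which — `𝔾'` being a graph — abuts to a vertex over `v`.  These
bijections are the combinatorial content of "a graph-covering of the underlying semi-graph
determines a finite étale covering of `𝒢`" (p. 23; the gluing isomorphisms of the attached object
of `B(𝒢)` permute the summands along them) and of Remark 3.5.1.

Contents: `Hom.VertexFiber`, `Hom.EdgeFiber`, `Hom.branchLift` (the branch over `b` at `v'`, for an
excision), `Hom.fiberEquivOfBranch` (the bijection, for an excision whose source is a graph) with
its characterising lemmas.  Deliberately NOT here: anabelioids (see `BaseChange.lean` and its
sequel), degrees / connectedness of coverings.
-/

namespace Literature.AnabelianGeometry.SemiGraphs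

namespace SemiGraph

open CategoryTheory

universe u

variable {G G' : SemiGraph.{u}} (ψ : G' ⟶ G)

/-- The fibre of a morphism of semi-graphs over a vertex. [cite: MochizukiSemiAnbd2006, §1 p.14] -/
abbrev Hom.VertexFiber (v : G.Vertex) : Type u := {v' : G'.Vertex // ψ.vertexMap v' = v}

/-- The fibre of a morphism of semi-graphs over an edge. [cite: MochizukiSemiAnbd2006, §1 p.14] -/
abbrev Hom.EdgeFiber (e : G.Edge) : Type u := {e' : G'.Edge // ψ.edgeMap e' = e}

variable {ψ}

/-- For an excision `ψ` and a branch `b` abutting to `v`: the unique branch over `b` abutting to a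
given vertex `v'` over `v` (inverse of the bijection of stars, p. 14).
[cite: MochizukiSemiAnbd2006, §1 p.14] -/
noncomputable def Hom.branchLift (hψ : IsExcision ψ) (b : G.Branch) (v : G.Vertex)
    (h : G.abuts b = some v) (v' : ψ.VertexFiber v) : G'.Star v'.1 :=
  (Equiv.ofBijective _ (hψ v'.1)).symm ⟨b, by rw [v'.2]; exact h⟩

/-- The lifted branch lies over `b`. [cite: MochizukiSemiAnbd2006, §1 p.14] -/
@[simp] theorem Hom.branchMap_branchLift (hψ : IsExcision ψ) (b : G.Branch) (v : G.Vertex)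
    (h : G.abuts b = some v) (v' : ψ.VertexFiber v) :
    ψ.branchMap (Hom.branchLift hψ b v h v').1 = b :=
  congrArg Subtype.val ((Equiv.ofBijective _ (hψ v'.1)).apply_symm_apply ⟨b, by rw [v'.2]; exact h⟩)

/-- The lifted branch abuts to `v'`. [cite: MochizukiSemiAnbd2006, §1 p.14] -/
theorem Hom.abuts_branchLift (hψ : IsExcision ψ) (b : G.Branch) (v : G.Vertex)
    (h : G.abuts b = some v) (v' : ψ.VertexFiber v) :
    G'.abuts (Hom.branchLift hψ b v h v').1 = some v'.1 :=
  (Hom.branchLift hψ b v h v').2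

/-- Uniqueness of the branch over `b` at `v'` (injectivity of the star map).
[cite: MochizukiSemiAnbd2006, §1 p.14] -/
theorem Hom.eq_branchLift (hψ : IsExcision ψ) (b : G.Branch) (v : G.Vertex)
    (h : G.abuts b = some v) (v' : ψ.VertexFiber v) (b' : G'.Branch)
    (hb' : G'.abuts b' = some v'.1) (hψb' : ψ.branchMap b' = b) :
    b' = (Hom.branchLift hψ b v h v').1 := by
  have hinj := (hψ v'.1).injective
  have key : Hom.starMap ψ v'.1 ⟨b', hb'⟩ = Hom.starMap ψ v'.1 (Hom.branchLift hψ b v h v') := by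
    apply Subtype.ext
    change ψ.branchMap b' = ψ.branchMap (Hom.branchLift hψ b v h v').1
    rw [hψb', Hom.branchMap_branchLift]
  exact congrArg Subtype.val (hinj key)

/-- The edge of the lifted branch lies over the edge of `b`. [cite: MochizukiSemiAnbd2006, §1 p.14] -/
theorem Hom.edgeMap_edgeOf_branchLift (hψ : IsExcision ψ) (b : G.Branch) (v : G.Vertex)
    (h : G.abuts b = some v) (v' : ψ.VertexFiber v) :
    ψ.edgeMap (G'.edgeOf (Hom.branchLift hψ b v h v').1) = G.edgeOf b := by
  rw [← ψ.edgeOf_branchMap, Hom.branchMap_branchLift]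

/-- Two branches of the same edge of `𝔾'` over the same branch of `𝔾` are equal (morphisms are
injective on the branches of an edge, p. 11). [cite: MochizukiSemiAnbd2006, §1 p.11] -/
theorem Hom.branch_eq_of_edgeOf_eq_of_branchMap_eq {b₁ b₂ : G'.Branch} (he : G'.edgeOf b₁ = G'.edgeOf b₂)
    (hb : ψ.branchMap b₁ = ψ.branchMap b₂) : b₁ = b₂ :=
  ψ.branchMap_injOn b₁ b₂ he hb

/-- For an edge `e'` over the edge of `b`: the branch of `e'` over `b` (it exists since the map on
the branches of an edge is a bijection, `Hom.exists_branchMap_eq`).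
[cite: MochizukiSemiAnbd2006, §1 p.11] -/
noncomputable def Hom.branchOver (b : G.Branch) (e' : ψ.EdgeFiber (G.edgeOf b)) : G'.Branch :=
  (Hom.exists_branchMap_eq ψ e'.1 b e'.2.symm).choose

/-- The chosen branch lies on `e'`. [cite: MochizukiSemiAnbd2006, §1 p.11] -/
@[simp] theorem Hom.edgeOf_branchOver (b : G.Branch) (e' : ψ.EdgeFiber (G.edgeOf b)) :
    G'.edgeOf (Hom.branchOver b e') = e'.1 :=
  (Hom.exists_branchMap_eq ψ e'.1 b e'.2.symm).choose_spec.1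

/-- The chosen branch lies over `b`. [cite: MochizukiSemiAnbd2006, §1 p.11] -/
@[simp] theorem Hom.branchMap_branchOver (b : G.Branch) (e' : ψ.EdgeFiber (G.edgeOf b)) :
    ψ.branchMap (Hom.branchOver b e') = b :=
  (Hom.exists_branchMap_eq ψ e'.1 b e'.2.symm).choose_spec.2

/-- In a graph `𝔾'`, the vertex to which the branch of `e'` over `b` abuts.
[cite: MochizukiSemiAnbd2006, §1 p.11] -/
noncomputable def Hom.vertexOver (hG' : G'.IsGraph) (b : G.Branch) (e' : ψ.EdgeFiber (G.edgeOf b)) :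
    G'.Vertex :=
  (G'.abuts (Hom.branchOver b e')).get (hG'.abuts_isSome _)

/-- The branch of `e'` over `b` abuts to `vertexOver`. [cite: MochizukiSemiAnbd2006, §1 p.11] -/
theorem Hom.abuts_branchOver (hG' : G'.IsGraph) (b : G.Branch) (e' : ψ.EdgeFiber (G.edgeOf b)) :
    G'.abuts (Hom.branchOver b e') = some (Hom.vertexOver hG' b e') := by
  simp [Hom.vertexOver]

/-- `vertexOver` lies over the vertex `b` abuts to. [cite: MochizukiSemiAnbd2006, §1 p.11] -/
theorem Hom.vertexMap_vertexOver (hG' : G'.IsGraph) (b : G.Branch) (v : G.Vertex)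
    (h : G.abuts b = some v) (e' : ψ.EdgeFiber (G.edgeOf b)) :
    ψ.vertexMap (Hom.vertexOver hG' b e') = v := by
  have h1 := ψ.abuts_branchMap _ _ (Hom.abuts_branchOver hG' b e')
  rw [Hom.branchMap_branchOver, h] at h1
  exact (Option.some_injective _ h1).symm

/-- **The branch bijection of a graph-covering** (p. 14 / p. 23): for an excision `ψ : 𝔾' → 𝔾`
with `𝔾'` a graph and a branch `b` of `e` abutting to `v`, the fibre over `v` is in bijection with
the fibre over `e`, `v' ↦` the edge of the branch over `b` at `v'`.
[cite: MochizukiSemiAnbd2006, §1 p.14] -/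
noncomputable def Hom.fiberEquivOfBranch (hψ : IsExcision ψ) (hG' : G'.IsGraph) (b : G.Branch)
    (v : G.Vertex) (h : G.abuts b = some v) : ψ.VertexFiber v ≃ ψ.EdgeFiber (G.edgeOf b) where
  toFun v' := ⟨G'.edgeOf (Hom.branchLift hψ b v h v').1, Hom.edgeMap_edgeOf_branchLift hψ b v h v'⟩
  invFun e' := ⟨Hom.vertexOver hG' b e', Hom.vertexMap_vertexOver hG' b v h e'⟩
  left_inv v' := by
    apply Subtype.ext
    -- the branch of the edge of the lift over `b` is the lift itself
    have hb : Hom.branchOver b ⟨G'.edgeOf (Hom.branchLift hψ b v h v').1,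
        Hom.edgeMap_edgeOf_branchLift hψ b v h v'⟩ = (Hom.branchLift hψ b v h v').1 :=
      Hom.branch_eq_of_edgeOf_eq_of_branchMap_eq (ψ := ψ) (by simp) (by simp)
    have h2 := Hom.abuts_branchOver hG' b ⟨G'.edgeOf (Hom.branchLift hψ b v h v').1,
        Hom.edgeMap_edgeOf_branchLift hψ b v h v'⟩
    rw [hb, Hom.abuts_branchLift] at h2
    exact (Option.some_injective _ h2).symm
  right_inv e' := by
    apply Subtype.ext
    -- the lift at `vertexOver` is the branch of `e'` over `b`
    have hb : Hom.branchOver b e' = (Hom.branchLift hψ b v h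
        ⟨Hom.vertexOver hG' b e', Hom.vertexMap_vertexOver hG' b v h e'⟩).1 :=
      Hom.eq_branchLift hψ b v h _ _ (Hom.abuts_branchOver hG' b e') (Hom.branchMap_branchOver b e')
    change G'.edgeOf (Hom.branchLift hψ b v h _).1 = e'.1
    rw [← hb, Hom.edgeOf_branchOver]

/-- The edge assigned to `v'` by the branch bijection is the edge of the branch over `b` at `v'`.
[cite: MochizukiSemiAnbd2006, §1 p.14] -/
@[simp] theorem Hom.fiberEquivOfBranch_apply_val (hψ : IsExcision ψ) (hG' : G'.IsGraph)
    (b : G.Branch) (v : G.Vertex) (h : G.abuts b = some v) (v' : ψ.VertexFiber v) :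
    (Hom.fiberEquivOfBranch hψ hG' b v h v').1 = G'.edgeOf (Hom.branchLift hψ b v h v').1 := rfl

/-- The vertex assigned to `e'` by the inverse branch bijection receives the branch of `e'` over `b`.
[cite: MochizukiSemiAnbd2006, §1 p.14] -/
theorem Hom.abuts_branchOver_symm (hψ : IsExcision ψ) (hG' : G'.IsGraph)
    (b : G.Branch) (v : G.Vertex) (h : G.abuts b = some v) (e' : ψ.EdgeFiber (G.edgeOf b)) :
    G'.abuts (Hom.branchOver b e') = some ((Hom.fiberEquivOfBranch hψ hG' b v h).symm e').1 :=
  Hom.abuts_branchOver hG' b e'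

end SemiGraph

end Literature.AnabelianGeometry.SemiGraphs
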